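import Summits.HubbardSuperconductivity.HubbardSuperconductivity.Theorems.ThermalWedgeTwSeededEnsembleEquivalenceRPbSectorSelection
import Summits.HubbardSuperconductivity.HubbardSuperconductivity.Theorems.ThermalWedgeTwSeededEnsembleEquivalenceRSectorWeightLipschitz
import Summits.HubbardSuperconductivity.HubbardSuperconductivity.Theorems.ThermalWedgeTwSeededEnsembleEquivalenceSectorWeightBasics
import Summits.HubbardSuperconductivity.HubbardSuperconductivity.Theorems.ThermalWedgeTwSeededRungSectorGibbs
import Literature.MathematicalPhysics.QuantumLattice.RegionalNumberCharge

/-!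
# Crux `TwSeededEnsembleEquivalenceR` (stmt-HubbardSuperconductivity-15581), line `cold-floor-collapse` (slug `Sketch`),
# skeleton v8 (block two-phase pinning) — registered stub `stub_seededSectorCalculus` (S7h)

Support file (`--supports stmt-HubbardSuperconductivity-15581`; sorry-free; no definition).
Sector-weight calculus of the seeded torus: positivity, log-Lipschitz transfer (S2), penalised PB selection at inverse temperature β (S1).
-/

set_option linter.dupNamespace false

namespace Summit.HubbardSuperconductivity.HubbardSuperconductivity.Theorems.TwSeededEnsembleEquivalenceR.ColdFloorLine

open Matrix Filter Topology Finset Literature.MathematicalPhysics.QuantumLattice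
open Literature.Barriers.HubbardSuperconductivity Literature.Probability.LatticeModels
open scoped ComplexOrder Matrix.Norms.L2Operator

noncomputable section

/-! ### Helper lemmas (private, prefixed `ssc_`) -/

/-- Inverse temperature versus coupling: `e^{-1·(βH)} = e^{-βH}`. [folklore] -/
private theorem ssc_gibbsWeight_one_smul {m : Type*} [Fintype m] [DecidableEq m] (β : ℝ) (H : Matrix m m ℂ) :
    gibbsWeight 1 ((β : ℂ) • H) = gibbsWeight β H := by
  rw [gibbsWeight, gibbsWeight, smul_smul, Complex.ofReal_one, neg_one_mul]

/-- `Z_1(βH) = Z_β(H)`. [folklore] -/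
private theorem ssc_partitionFn_one_smul {m : Type*} [Fintype m] [DecidableEq m] (β : ℝ) (H : Matrix m m ℂ) :
    partitionFn 1 ((β : ℂ) • H) = partitionFn β H := by
  rw [partitionFn, partitionFn, ssc_gibbsWeight_one_smul]

/-- `⟨A⟩_{1, βH} = ⟨A⟩_{β, H}`. [folklore] -/
private theorem ssc_gibbsState_one_smul {m : Type*} [Fintype m] [DecidableEq m] (β : ℝ) (H A : Matrix m m ℂ) :
    gibbsState 1 ((β : ℂ) • H) A = gibbsState β H A := by
  rw [gibbsState_apply, gibbsState_apply, ssc_partitionFn_one_smul, ssc_gibbsWeight_one_smul]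

/-- `Re ⟨r A⟩ = r Re ⟨A⟩` for real `r` (linearity of the Gibbs state). [folklore] -/
private theorem ssc_re_gibbsState_ofReal_smul {m : Type*} [Fintype m] [DecidableEq m] (β : ℝ) (H : Matrix m m ℂ)
    (r : ℝ) (A : Matrix m m ℂ) :
    (gibbsState β H ((r : ℂ) • A)).re = r * (gibbsState β H A).re := by
  rw [map_smul, smul_eq_mul, Complex.re_ofReal_mul]

/-- The elementary log-Lipschitz step: if `a W₀ ≤ b E W₁`, `b W₁ ≤ a E W₀` with `b ≤ 3a`, `a ≤ 3b`
(all quantities positive) then `|log W₁ − log W₀| ≤ log E + log 3`. [folklore] -/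
private theorem ssc_logLip {a b E W0 W1 : ℝ} (ha : 0 < a) (hb : 0 < b) (hE : 0 < E) (hW0 : 0 < W0) (hW1 : 0 < W1)
    (h1 : a * W0 ≤ b * E * W1) (h2 : b * W1 ≤ a * E * W0) (hab : b ≤ 3 * a) (hba : a ≤ 3 * b) :
    |Real.log W1 - Real.log W0| ≤ Real.log E + Real.log 3 := by
  have h3 : (0 : ℝ) < 3 := by norm_num
  have hW0le : W0 ≤ 3 * E * W1 := by
    have : a * W0 ≤ a * (3 * E * W1) := by nlinarith [mul_pos hE hW1]
    exact le_of_mul_le_mul_left this ha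
  have hW1le : W1 ≤ 3 * E * W0 := by
    have : b * W1 ≤ b * (3 * E * W0) := by nlinarith [mul_pos hE hW0]
    exact le_of_mul_le_mul_left this hb
  have hl0 := Real.log_le_log hW0 hW0le
  have hl1 := Real.log_le_log hW1 hW1le
  rw [Real.log_mul (mul_pos h3 hE).ne' hW1.ne', Real.log_mul h3.ne' hE.ne'] at hl0
  rw [Real.log_mul (mul_pos h3 hE).ne' hW0.ne', Real.log_mul h3.ne' hE.ne'] at hl1
  rw [abs_sub_le_iff]
  constructor <;> linarith

variable (L : ℕ)

/-- The particle numbers on the `L × L` torus take at most `2L² + 1` values. [folklore] -/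
private theorem ssc_card_image_card_le :
    ((Finset.univ : Finset (Finset (Orb (FermionTorus 2 L)))).image Finset.card).card ≤ 2 * L ^ 2 + 1 := by
  have hsub : (Finset.univ : Finset (Finset (Orb (FermionTorus 2 L)))).image Finset.card ⊆
      Finset.range (2 * L ^ 2 + 1) := by
    intro N hN
    obtain ⟨s, -, rfl⟩ := Finset.mem_image.1 hN
    rw [Finset.mem_range]
    have h := Finset.card_le_univ s
    rw [card_orb_fermionTorus_two] at h
    omega
  exact (Finset.card_le_card hsub).trans (Finset.card_range _).le

/-- A particle number on the `L × L` torus is at most `2L²`. [folklore] -/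
private theorem ssc_mem_image_card_le {N : ℕ}
    (hN : N ∈ (Finset.univ : Finset (Finset (Orb (FermionTorus 2 L)))).image Finset.card) : N ≤ 2 * L ^ 2 := by
  obtain ⟨s, -, rfl⟩ := Finset.mem_image.1 hN
  have h := Finset.card_le_univ s
  rwa [card_orb_fermionTorus_two] at h

/-- The quadratic number penalty is `t (N̂ − c)²` (`N̂ = diagonal |s|`). [folklore] -/
private theorem ssc_diag_penalty (t c : ℝ) :
    (Matrix.diagonal fun s : Finset (Orb (FermionTorus 2 L)) => ((t * ((s.card : ℝ) - c) ^ 2 : ℝ) : ℂ)) =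
      (t : ℂ) • (((totalNumber : Matrix (Finset (Orb (FermionTorus 2 L))) (Finset (Orb (FermionTorus 2 L))) ℂ) -
          (c : ℂ) • (1 : Matrix (Finset (Orb (FermionTorus 2 L))) (Finset (Orb (FermionTorus 2 L))) ℂ)) *
        ((totalNumber : Matrix (Finset (Orb (FermionTorus 2 L))) (Finset (Orb (FermionTorus 2 L))) ℂ) -
          (c : ℂ) • (1 : Matrix (Finset (Orb (FermionTorus 2 L))) (Finset (Orb (FermionTorus 2 L))) ℂ))) := by
  have hN : (totalNumber : Matrix (Finset (Orb (FermionTorus 2 L))) (Finset (Orb (FermionTorus 2 L))) ℂ) =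
      diagonal fun s => (s.card : ℂ) := by
    convert totalNumber_torus_eq_diagonal L
  have hsub : (diagonal fun s : Finset (Orb (FermionTorus 2 L)) => (s.card : ℂ)) -
      (c : ℂ) • (1 : Matrix (Finset (Orb (FermionTorus 2 L))) (Finset (Orb (FermionTorus 2 L))) ℂ) =
      diagonal fun s => ((s.card : ℂ) - c) := by
    rw [smul_eq_diagonal_mul, mul_one, diagonal_sub]
  rw [hN, hsub, diagonal_mul_diagonal, smul_eq_diagonal_mul, diagonal_mul_diagonal]
  congr 1
  funext s
  push_cast
  ring

/-- **S7h `stub_seededSectorCalculus` (sector-weight calculus of the seeded torus: positivity, log-Lipschitz transfer, penalised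
Peierls–Bogoliubov selection at inverse temperature `β`).** For `K = hubbardTorusWith 2 L 1 U μ − (g/L²)ΔᴴΔ` and its particle-number
sector weights `W(N) = Σ_{|s|=N} Re (e^{−βK})_{ss}`: (a) `W(N) > 0` for `N ≤ 2L²` (`stub_sectorWeightBasics`); (b) on `L²/2 ≤ N ≤ 3L²/2 − 1`,
`|log W(N+1) − log W(N)| ≤ βC_F + log 3` (S2 `stub_sectorWeightLipschitz` + the ratio bounds `(N+1)/(2L²−N), (2L²−N)/(N+1) ≤ 3`);
(c) for every Hermitian trial `Kt`, `t ≥ 0`, `c`: some sector `N ≤ 2L²` has `W(N) ≤ Re Z_β(K)` and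
`log Re Z_β(K) − log W(N) ≤ [log Re Z_β(K) − log Re Z_β(Kt) + β Re⟨K − Kt⟩_{β,Kt}] + t Re⟨(N̂ − c)²⟩_{β,Kt} + log(2L²+1) − t(N − c)²`
(S1 `stub_pbSectorSelection` at `β = 1` with `K₁ := β•K`, `Kt₁ := β•Kt`, `deg := card`: `e^{−1·(βH)} = e^{−βH}`, number conservation
`tw_preservesSectors_seededGC`, `#image card ≤ 2L²+1`, `diagonal (t(|s|−c)²) = t(N̂ − c)²` since `N̂ = diagonal |s|`). [folklore composition] -/
theorem stub_seededSectorCalculus :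
    ∀ (U g μ : ℝ), 0 ≤ U → 0 ≤ g → ∃ CF : ℝ, 0 ≤ CF ∧ ∀ (β : ℝ), 0 < β → ∀ (L : ℕ) [NeZero L],
      (∀ N : ℕ, N ≤ 2 * L ^ 2 → 0 < (∑ s ∈ (Finset.univ.filter fun s : Finset (Orb (FermionTorus 2 L)) => s.card = N), (Matrix.gibbsWeight β (hubbardTorusWith 2 L 1 U μ - ((g / (L : ℝ) ^ 2 : ℝ) : ℂ) • ((pairField dWaveFormFactor L)ᴴ * pairField dWaveFormFactor L)) s s).re)) ∧
      (∀ N : ℕ, L ^ 2 ≤ 2 * N → 2 * (N + 1) ≤ 3 * L ^ 2 →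
        |Real.log (∑ s ∈ (Finset.univ.filter fun s : Finset (Orb (FermionTorus 2 L)) => s.card = (N + 1)), (Matrix.gibbsWeight β (hubbardTorusWith 2 L 1 U μ - ((g / (L : ℝ) ^ 2 : ℝ) : ℂ) • ((pairField dWaveFormFactor L)ᴴ * pairField dWaveFormFactor L)) s s).re) - Real.log (∑ s ∈ (Finset.univ.filter fun s : Finset (Orb (FermionTorus 2 L)) => s.card = N), (Matrix.gibbsWeight β (hubbardTorusWith 2 L 1 U μ - ((g / (L : ℝ) ^ 2 : ℝ) : ℂ) • ((pairField dWaveFormFactor L)ᴴ * pairField dWaveFormFactor L)) s s).re)| ≤ β * CF + Real.log 3) ∧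
      (∀ (Kt : Matrix (Finset (Orb (FermionTorus 2 L))) (Finset (Orb (FermionTorus 2 L))) ℂ), Kt.IsHermitian →
        ∀ (t c : ℝ), 0 ≤ t → ∃ N : ℕ, N ≤ 2 * L ^ 2 ∧ (∑ s ∈ (Finset.univ.filter fun s : Finset (Orb (FermionTorus 2 L)) => s.card = N), (Matrix.gibbsWeight β (hubbardTorusWith 2 L 1 U μ - ((g / (L : ℝ) ^ 2 : ℝ) : ℂ) • ((pairField dWaveFormFactor L)ᴴ * pairField dWaveFormFactor L)) s s).re) ≤ (Matrix.partitionFn β (hubbardTorusWith 2 L 1 U μ - ((g / (L : ℝ) ^ 2 : ℝ) : ℂ) • ((pairField dWaveFormFactor L)ᴴ * pairField dWaveFormFactor L))).re ∧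
          Real.log (Matrix.partitionFn β (hubbardTorusWith 2 L 1 U μ - ((g / (L : ℝ) ^ 2 : ℝ) : ℂ) • ((pairField dWaveFormFactor L)ᴴ * pairField dWaveFormFactor L))).re - Real.log (∑ s ∈ (Finset.univ.filter fun s : Finset (Orb (FermionTorus 2 L)) => s.card = N), (Matrix.gibbsWeight β (hubbardTorusWith 2 L 1 U μ - ((g / (L : ℝ) ^ 2 : ℝ) : ℂ) • ((pairField dWaveFormFactor L)ᴴ * pairField dWaveFormFactor L)) s s).re) ≤
            Real.log (Matrix.partitionFn β (hubbardTorusWith 2 L 1 U μ - ((g / (L : ℝ) ^ 2 : ℝ) : ℂ) • ((pairField dWaveFormFactor L)ᴴ * pairField dWaveFormFactor L))).re - Real.log (Matrix.partitionFn β Kt).re + β * (Matrix.gibbsState β Kt ((hubbardTorusWith 2 L 1 U μ - ((g / (L : ℝ) ^ 2 : ℝ) : ℂ) • ((pairField dWaveFormFactor L)ᴴ * pairField dWaveFormFactor L)) - Kt)).re +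
              t * (Matrix.gibbsState β Kt (((totalNumber : Matrix (Finset (Orb (FermionTorus 2 L))) (Finset (Orb (FermionTorus 2 L))) ℂ) - (c : ℂ) • (1 : Matrix (Finset (Orb (FermionTorus 2 L))) (Finset (Orb (FermionTorus 2 L))) ℂ)) * ((totalNumber : Matrix (Finset (Orb (FermionTorus 2 L))) (Finset (Orb (FermionTorus 2 L))) ℂ) - (c : ℂ) • (1 : Matrix (Finset (Orb (FermionTorus 2 L))) (Finset (Orb (FermionTorus 2 L))) ℂ)))).re +
              Real.log (2 * (L : ℝ) ^ 2 + 1) - t * ((N : ℝ) - c) ^ 2) := by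
  intro U g μ hU hg
  obtain ⟨C, hC0, hC⟩ := stub_sectorWeightLipschitz U g μ hU hg
  refine ⟨C, hC0, fun β hβ L _ => ?_⟩
  obtain ⟨hZsum, -, hpos, -⟩ :=
    Summit.HubbardSuperconductivity.HubbardSuperconductivity.Theorems.TwSeededEnsembleEquivalence.ThermalDuality.stub_sectorWeightBasics
      L U g β hβ
  set K := hubbardTorusWith 2 L 1 U μ - ((g / (L : ℝ) ^ 2 : ℝ) : ℂ) •
    ((pairField dWaveFormFactor L)ᴴ * pairField dWaveFormFactor L) with hKdef
  refine ⟨fun N hN => hpos μ N hN, fun N hLN hNL => ?_, fun Kt hKt t c ht => ?_⟩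
  · -- (b) log-Lipschitz transfer
    obtain ⟨h1, h2⟩ := hC β hβ L N hLN hNL
    have hN1 : N + 1 ≤ 2 * L ^ 2 := by
      set X := L ^ 2 with hX
      omega
    have hW0 := hpos μ N (by omega)
    have hW1 := hpos μ (N + 1) hN1
    have hNR : 2 * ((N : ℝ) + 1) ≤ 3 * (L : ℝ) ^ 2 := by exact_mod_cast hNL
    have hLR : (L : ℝ) ^ 2 ≤ 2 * N := by exact_mod_cast hLN
    have h := ssc_logLip (a := 2 * (L : ℝ) ^ 2 - N) (b := (N : ℝ) + 1) (by nlinarith [sq_nonneg (L : ℝ)])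
      (by positivity) (Real.exp_pos (β * C)) hW0 hW1 h1 h2 (by linarith) (by linarith)
    rwa [Real.log_exp] at h
  · -- (c) penalised Peierls–Bogoliubov selection at inverse temperature `β`
    have hKh : K.IsHermitian := tw_isHermitian_seededGC L U μ g
    have hβsa : IsSelfAdjoint (β : ℂ) := isSelfAdjoint_iff.2 (Complex.conj_ofReal _)
    have hdeg : ∀ i j : Finset (Orb (FermionTorus 2 L)), ((β : ℂ) • K) i j ≠ 0 → i.card = j.card := by
      intro s s' h
      rw [Matrix.smul_apply, smul_eq_mul] at h
      obtain ⟨h1, h2⟩ := tw_preservesSectors_seededGC L U μ g s s' (right_ne_zero_of_mul h)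
      rw [card_eq_upPart_add_downPart s, card_eq_upPart_add_downPart s', h1, h2]
    obtain ⟨N, hNmem, hsel⟩ := stub_pbSectorSelection (Finset (Orb (FermionTorus 2 L))) Finset.card
      ((β : ℂ) • K) ((β : ℂ) • Kt) (hKh.smul hβsa) (hKt.smul hβsa) hdeg t c ht
    rw [ssc_partitionFn_one_smul, ← smul_sub, ssc_gibbsState_one_smul, ssc_gibbsState_one_smul,
      ssc_re_gibbsState_ofReal_smul, ssc_diag_penalty L t c, ssc_re_gibbsState_ofReal_smul,
      ssc_gibbsWeight_one_smul] at hsel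
    have hNle : N ≤ 2 * L ^ 2 := ssc_mem_image_card_le L hNmem
    have hZ : (∑ s ∈ (Finset.univ.filter fun s : Finset (Orb (FermionTorus 2 L)) => s.card = N),
        (Matrix.gibbsWeight β K s s).re) ≤ (Matrix.partitionFn β K).re := by
      rw [hZsum μ]
      exact Finset.single_le_sum (f := fun M => ∑ s ∈ (Finset.univ.filter
          fun s : Finset (Orb (FermionTorus 2 L)) => s.card = M), (Matrix.gibbsWeight β K s s).re)
        (fun M hM => (hpos μ M (Nat.lt_succ_iff.1 (Finset.mem_range.1 hM))).le)
        (Finset.mem_range.2 (Nat.lt_succ_of_le hNle))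
    have hcardpos : (0 : ℝ) < (((Finset.univ : Finset (Finset (Orb (FermionTorus 2 L)))).image Finset.card).card : ℝ) :=
      Nat.cast_pos.2 (Finset.card_pos.2 (Finset.univ_nonempty.image _))
    have hlogcard : Real.log (((Finset.univ : Finset (Finset (Orb (FermionTorus 2 L)))).image Finset.card).card : ℝ) ≤
        Real.log (2 * (L : ℝ) ^ 2 + 1) := by
      refine Real.log_le_log hcardpos ?_
      have h := ssc_card_image_card_le L
      exact_mod_cast h
    refine ⟨N, hNle, hZ, ?_⟩
    linarith

end

end Summit.HubbardSuperconductivity.HubbardSuperconductivity.Theorems.TwSeededEnsembleEquivalenceR.ColdFloorLine
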